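import Summits.QuantumFields.BalabanUV.T4Continuum.Support.NE7CoarseCurvatureLetter
import Summits.QuantumFields.BalabanUV.T4Continuum.Support.NE3QuadRemainderLocality
import Summits.QuantumFields.BalabanUV.T4Continuum.Support.NE7ApeFlatSkeletonLocal
import HarnessLib

/-!
# NE7CoarseCurvatureLetterLocal — F43's COARSE-CURVATURE LETTER READ AT ONE COARSE PLAQUETTE, and the LOCALITY of the nonlinear averaging tower: if the representative
# `F̃e^{A}` AGREES with a configuration `V` on the dependency balls of the four bonds of a coarse plaquette `c`, then the coarse curl of the linearised average `D_1A`
# AT `c` is bounded by the plaquette of `V`'s `(k+1)`-fold average at `c` plus the quadratic linearisation error `O((Mα₀)²)` — (N3)″'s NEAR part for the torus road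
# (`V = U^u` on the cube, whose average is a gauge transform of the datum: plaquettes `β_c`)

Cell `pub-balaban`, rung (B)+1 sub-cell t4, lineage `b2b-balaban-t4-ne7-p1` (CRUX PROVER NE7 #1 = OWNER of row NE7), generation 89; memo
`t4/b2b-balaban-t4-ne7-p1-g89/COSTING-N1.md` §1, §5 (5).  File F259 (over F43 `NE7CoarseCurvatureLetter` — its proof read pointwise —, row NE3's one-step locality
`NE3QuadRemainderLocality.bavg_congr_of_l1 ∕ l1_le_depRad_succ`, F245 `NE7ApeFlatSkeletonLocal.hol_plaqWord_congr`).

WHY.  The v3 END (F257 `NE7ApeOfTorusRoadV3`) asks per plaquette for a bound `ĝ` on the coarse curl of the NEAR datum `φ₁ = c₀·D_1A_loc` — which by F258's split and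
F248's weighted Leibniz reduces to the coarse curl of `D_1A_loc` near the plaquette and the size of `D_1A_loc` there.  F43 `coarseCurl_le` bounds the coarse curl of
`D_1A` by the plaquette radius of the AVERAGED representative — GLOBALLY (`SmallField (cavgIter (F̃e^{A})) β′`), which the cut-off representative of the torus road does
not have (its average is the datum only where the cutoff is `1`).  But F43's proof is pointwise: it reads the averaged representative's plaquette AT `c` only.  THIS FILE
states that pointwise form and supplies the plaquette at `c` from a configuration `V` that agrees with the representative on the dependency balls (the tower's
nonlinear average is LOCAL: `cavgIter_congr_of_l1`, the twin of row NE3's `dirIter_congr_of_l1`).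
WHAT ([folklore]; 0 def, 0 sorry).
§1 `cavg_congr_of_l1`, **`cavgIter_congr_of_l1`** — configurations agreeing on the `l1`-ball of radius `depRad d L j` about `L^j•z` have the same `j`-fold average on
   every bond from `z`.
§2 **`coarseCurl_le_at`** — F43 `coarseCurl_le` with the hypothesis on the averaged representative's plaquette AT the coarse plaquette `(c; μ ≠ ν)` only.
§3 **`coarseCurl_le_of_agree`** — if `vary F̃ A 1 = V` on the four dependency balls of the coarse plaquette at `c` and `‖(cavgIter L (k+1) V)(∂c) − 1‖ ≤ β′`, then
   `‖curlAt (cavgIter L (k+1) F̃) (dirIter L (k+1) F̃ A) c μ ν‖ ≤ β′ + 28(b₀ + q)² + 4q` (`b₀ = (3+12d)Mα₀`, `q = 4(3+12d)³ρ₀⁻²(Mα₀)²`).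
HONEST FRAMING (page 1): lattice bookkeeping over row NE3's tower letters; nothing of Bałaban's asserted; NOT (APE), NOT ONE-STEP, NOT NE7; spine 0∕9; finite T⁴ rung (B)+1
— NOT infinite volume, NOT mass gap, NOT `BetaPertH`, NOT Clay.  Continuum YM on T⁴ ⇐ BetaPertH ∧ nine spine estimates (0/9 proved); BetaPertH ⇐ (D1) ∧ (D4) ∧ CAP+tail;
G-an2-4 gates asym, D1 and NE2/3/4.
-/

set_option autoImplicit false

open scoped BigOperators Matrix.Norms.L2Operator
open Finset

namespace Summit.QuantumFields.BalabanUV.T4Continuum.NE7CoarseCurvatureLetterLocal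

open Literature.MathematicalPhysics.QuantumFieldTheory.Balaban1983to89
open B7Prop1Explicit B7Prop2Explicit MatrixLog UnitaryModel
open T4AveragingDeficitWall (IsUnitaryCfg IsSkewDir SmallField vary curlAt vary_zero)
open T4AveragingDeficitWallBoundary (IsPeriodicCfg)
open AveragingDeficitPeriodicCounting (IsPeriodicDir)
open AveragingDeficitChartCalculus (cavg)
open AveragingDeficitMultiLevelPrep (cavgIter radIter LevelSmall tower)
open AveragingDeficitMultiLevelBridge (tower_eq)
open BlockAverageVaryDisc (rho0 rho0_pos)
open BlockAverageVaryHolo (nbRad)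
open NE3TangentCovariantTower (dirIter)
open NE3LinearisedAverageSup (curv curvSum norm_dirIter_le_sup levelData)
open NE3QuadRemainderTower (relIter)
open NE3QuadRemainderSup (norm_relIter_sub_dirIter_le cavgIter_vary_eq_vary_relIter_of_tower relIter_skew_of_tower)
open NE3QuadRemainderLocality (depRad bavg_congr_of_l1 l1_le_depRad_succ)
open NE3HessBounds (bondSqAt norm_curlAt_le)
open NE3EnergyHessBilin (curlAt_add)
open NE7SegmentPlaquetteRadius (norm_hol_taylor_le bondSqAt_le_of_sup)
open NE7CoarseCurvatureLetter (levelSmall_zero curvSum_zero norm_curlAt_flat_le_hol_sub_one norm_curlAt_le_four_mul)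
open NE7ApeFlatSkeletonLocal (hol_plaqWord_congr)

noncomputable section

variable {d : ℕ} {n : Type*} [Fintype n] [DecidableEq n]

/-! ## §1 Locality of the nonlinear averaging tower -/

/-- one level: configurations agreeing on the `l1`-ball of radius `nbRad` about `L•y` have the same block average on every bond from `y`
(`NE3QuadRemainderLocality.bavg_congr_of_l1`). [folklore] -/
theorem cavg_congr_of_l1 (L : ℕ) {U U' : Site d → Fin d → (Matrix n n ℂ)ˣ} (y : Site d)
    (h : ∀ (x : Site d) (μ : Fin d), l1 (x - (L : ℤ) • y) ≤ nbRad d L → U x μ = U' x μ) (κ : Fin d) :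
    cavg L U y κ = cavg L U' y κ :=
  bavg_congr_of_l1 L ((L : ℤ) • y) κ h

/-- **LOCALITY OF THE `j`-FOLD NONLINEAR AVERAGE**: configurations agreeing on the `l1`-ball of radius `depRad d L j` about `L^j•z` have the same `j`-fold average on every
bond from `z` (induction as row NE3's `dirIter_congr_of_l1`). [cite: Balaban1985Averaging, p.24 (locality of the averaging operations)] -/
theorem cavgIter_congr_of_l1 (L : ℕ) : ∀ (j : ℕ) {U U' : Site d → Fin d → (Matrix n n ℂ)ˣ} (z : Site d),
    (∀ (x : Site d) (μ : Fin d), l1 (x - ((L : ℤ) ^ j) • z) ≤ depRad d L j → U x μ = U' x μ) →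
    ∀ κ : Fin d, cavgIter L j U z κ = cavgIter L j U' z κ
  | 0, U, U', z, h, κ => by
      have := h z κ (by simp [depRad, l1])
      simpa [cavgIter] using this
  | j + 1, U, U', z, h, κ => by
      show cavgIter L j (cavg L U) z κ = cavgIter L j (cavg L U') z κ
      refine cavgIter_congr_of_l1 L j z (fun y μ hy => ?_) κ
      exact cavg_congr_of_l1 L y (fun x μ' hx => h x μ' (l1_le_depRad_succ L j hx hy)) μ

/-! ## §2 F43's coarse-curvature letter at one coarse plaquette -/

/-- **THE COARSE-CURVATURE LETTER, POINTWISE** (F43 `coarseCurl_le` with the averaged representative's plaquette asked AT `(c; μ ≠ ν)` only): for a flat `F̃` in the tower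
class at radius `0` whose `(k+1)`-fold average `F` is flat, `A` skew periodic with `‖A‖ ≤ α₀` and the regularity line, and
`‖(cavgIter L (k+1) (F̃e^{A}))(∂c_{μν}) − 1‖ ≤ β′`:  `‖curlAt F (D_1A) c μ ν‖ ≤ β′ + 28(b₀ + q)² + 4q`. [folklore] -/
theorem coarseCurl_le_at [Nonempty n] {L N : ℕ} [NeZero N] (hL : 2 ≤ L) (k : ℕ) {Ft : Site d → Fin d → (Matrix n n ℂ)ˣ}
    (hFt : IsUnitaryCfg Ft) (hFtP : IsPeriodicCfg Ft ((L ^ (k + 1) * N : ℕ) : ℤ)) (hFt0 : SmallField Ft 0)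
    (hF0 : SmallField (cavgIter L (k + 1) Ft) 0)
    {A : Site d → Fin d → Matrix n n ℂ} (hA : IsSkewDir A) (hAP : IsPeriodicDir A ((L ^ (k + 1) * N : ℕ) : ℤ)) {α₀ : ℝ} (hα₀ : 0 ≤ α₀)
    (hAα : ∀ y μ, ‖A y μ‖ ≤ α₀) (hreg : 4 * (3 + 12 * (d : ℝ)) ^ 2 * (L : ℝ) ^ (k + 1) * α₀ ≤ rho0 d L ^ 2)
    {β' : ℝ} (c : Site d) {μ ν : Fin d} (hμν : μ ≠ ν)
    (hDc : ‖((hol (cavgIter L (k + 1) (vary Ft A 1)) c (plaqWord μ ν) : (Matrix n n ℂ)ˣ) : Matrix n n ℂ) - 1‖ ≤ β') :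
    ‖curlAt (cavgIter L (k + 1) Ft) (dirIter L (k + 1) Ft A) c μ ν‖
      ≤ β' + 28 * ((3 + 12 * (d : ℝ)) * ((L : ℝ) ^ (k + 1) * α₀) + 4 * (3 + 12 * (d : ℝ)) ^ 3 / rho0 d L ^ 2 * ((L : ℝ) ^ (k + 1) * α₀) ^ 2) ^ 2
        + 4 * (4 * (3 + 12 * (d : ℝ)) ^ 3 / rho0 d L ^ 2 * ((L : ℝ) ^ (k + 1) * α₀) ^ 2) := by
  have hL1 : 1 ≤ L := by omega
  have hx : (0 : ℝ) ≤ 0 := le_rfl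
  have hs : LevelSmall d L (k + 1) 0 := levelSmall_zero L (k + 1)
  have hs' : LevelSmall d L k 0 := levelSmall_zero L k
  have hcurv : curvSum d L (k + 1) 0 ≤ 2 / 3 * L := by rw [curvSum_zero]; positivity
  set F := cavgIter L (k + 1) Ft with hFdef
  set φ := dirIter L (k + 1) Ft A with hφ
  set B := relIter L (k + 1) Ft A with hBdef
  set q : ℝ := 4 * (3 + 12 * (d : ℝ)) ^ 3 / rho0 d L ^ 2 * ((L : ℝ) ^ (k + 1) * α₀) ^ 2 with hq
  set b₀ : ℝ := (3 + 12 * (d : ℝ)) * ((L : ℝ) ^ (k + 1) * α₀) with hb₀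
  have hFu : IsUnitaryCfg F := (levelData hL1 hFt hx hs hFt0 (m := k + 1) (by omega)).1
  -- the log-coordinate of the averaged representative and its quadratic remainder (row NE3)
  have hvary : cavgIter L (k + 1) (vary Ft A 1) = vary F B 1 :=
    cavgIter_vary_eq_vary_relIter_of_tower hL hFt hFtP hx hs hFt0 hcurv hA hAP hα₀ hAα hreg le_rfl
  have hBs : IsSkewDir B := relIter_skew_of_tower hL hFt hFtP hx hs hFt0 hcurv hA hAP hα₀ hAα hreg le_rfl
  have hquad : ∀ (z : Site d) (κ : Fin d), ‖B z κ - φ z κ‖ ≤ q := fun z κ =>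
    norm_relIter_sub_dirIter_le hL hFt hFtP hx hs hFt0 hcurv hA hAP hα₀ hAα hreg (k + 1) le_rfl z κ
  -- the sup letter of the linearised average (row NE3)
  have htow : ((tower L N (k + 1) : ℕ) : ℤ) = ((L ^ (k + 1) * N : ℕ) : ℤ) := by rw [tower_eq, mul_comm]
  have hFtP' : IsPeriodicCfg Ft ((tower L N (k + 1) : ℕ) : ℤ) := by rw [htow]; exact hFtP
  have hAP' : IsPeriodicDir A ((tower L N (k + 1) : ℕ) : ℤ) := by rw [htow]; exact hAP
  have hsup : ∀ (z : Site d) (κ : Fin d), ‖φ z κ‖ ≤ b₀ := fun z κ => by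
    have h := norm_dirIter_le_sup hL k hFt hFtP' hx hs' hFt0 hA hAP' hα₀ hAα hcurv z κ
    rw [hb₀]; linarith
  have hBb : ∀ (z : Site d) (κ : Fin d), ‖B z κ‖ ≤ b₀ + q := fun z κ => by
    have h1 : ‖B z κ‖ ≤ ‖B z κ - φ z κ‖ + ‖φ z κ‖ := by
      have := norm_add_le (B z κ - φ z κ) (φ z κ); rwa [sub_add_cancel] at this
    linarith [hquad z κ, hsup z κ]
  -- the plaquette of the averaged representative AT `c`, read through the log-coordinate
  have hhol : ‖((hol (vary F B 1) c (plaqWord μ ν) : (Matrix n n ℂ)ˣ) : Matrix n n ℂ) - 1‖ ≤ β' := by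
    rw [← hvary]; exact hDc
  have hcB : ‖curlAt F B c μ ν‖ ≤ β' + 28 * (b₀ + q) ^ 2 :=
    (norm_curlAt_flat_le_hol_sub_one hFu hF0 hBs hBb c hμν).trans (by linarith)
  have hcD : ‖curlAt F (fun y κ => B y κ - φ y κ) c μ ν‖ ≤ 4 * q := norm_curlAt_le_four_mul hFu hquad c μ ν
  have hsplit : curlAt F φ c μ ν = curlAt F B c μ ν - curlAt F (fun y κ => B y κ - φ y κ) c μ ν := by
    have hφB : φ = B + fun y κ => -(B y κ - φ y κ) := by funext y κ; simp
    conv_lhs => rw [hφB]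
    rw [curlAt_add]
    have hneg : (fun y κ => -(B y κ - φ y κ)) = (-1 : ℝ) • fun y κ => B y κ - φ y κ := by funext y κ; simp
    rw [hneg, NE3EnergyHessBilin.curlAt_smul]
    simp [sub_eq_add_neg]
  rw [hsplit]
  calc ‖curlAt F B c μ ν - curlAt F (fun y κ => B y κ - φ y κ) c μ ν‖
      ≤ ‖curlAt F B c μ ν‖ + ‖curlAt F (fun y κ => B y κ - φ y κ) c μ ν‖ := norm_sub_le _ _
    _ ≤ β' + 28 * (b₀ + q) ^ 2 + 4 * q := add_le_add hcB hcD

/-! ## §3 The plaquette at `c` from a configuration agreeing with the representative near `c` -/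

/-- **THE COARSE CURL OF `D_1A` AT `c` FROM LOCAL AGREEMENT**: if the representative `F̃e^{A}` agrees with `V` on the `l1`-balls of radius `depRad d L (k+1)` about the
corners `L^{k+1}•c`, `L^{k+1}•(c + e_μ)`, `L^{k+1}•(c + e_ν)` (the four bonds of the coarse plaquette), and `‖(cavgIter L (k+1) V)(∂c_{μν}) − 1‖ ≤ β′`, then F43's bound
holds at `c` (§1 + F245's `hol_plaqWord_congr` + §2).  In the torus road: `V = U^u` on the cube, `cavgIter (U^u) = D^{ū}` (gauge covariance), plaquettes `≤ β_c`. [folklore] -/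
theorem coarseCurl_le_of_agree [Nonempty n] {L N : ℕ} [NeZero N] (hL : 2 ≤ L) (k : ℕ) {Ft : Site d → Fin d → (Matrix n n ℂ)ˣ}
    (hFt : IsUnitaryCfg Ft) (hFtP : IsPeriodicCfg Ft ((L ^ (k + 1) * N : ℕ) : ℤ)) (hFt0 : SmallField Ft 0)
    (hF0 : SmallField (cavgIter L (k + 1) Ft) 0)
    {A : Site d → Fin d → Matrix n n ℂ} (hA : IsSkewDir A) (hAP : IsPeriodicDir A ((L ^ (k + 1) * N : ℕ) : ℤ)) {α₀ : ℝ} (hα₀ : 0 ≤ α₀)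
    (hAα : ∀ y μ, ‖A y μ‖ ≤ α₀) (hreg : 4 * (3 + 12 * (d : ℝ)) ^ 2 * (L : ℝ) ^ (k + 1) * α₀ ≤ rho0 d L ^ 2)
    {V : Site d → Fin d → (Matrix n n ℂ)ˣ} {β' : ℝ} (c : Site d) {μ ν : Fin d} (hμν : μ ≠ ν)
    (hagree : ∀ (x : Site d) (κ : Fin d),
      (l1 (x - ((L : ℤ) ^ (k + 1)) • c) ≤ depRad d L (k + 1) ∨ l1 (x - ((L : ℤ) ^ (k + 1)) • (c + e μ)) ≤ depRad d L (k + 1)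
        ∨ l1 (x - ((L : ℤ) ^ (k + 1)) • (c + e ν)) ≤ depRad d L (k + 1)) → vary Ft A 1 x κ = V x κ)
    (hVc : ‖((hol (cavgIter L (k + 1) V) c (plaqWord μ ν) : (Matrix n n ℂ)ˣ) : Matrix n n ℂ) - 1‖ ≤ β') :
    ‖curlAt (cavgIter L (k + 1) Ft) (dirIter L (k + 1) Ft A) c μ ν‖
      ≤ β' + 28 * ((3 + 12 * (d : ℝ)) * ((L : ℝ) ^ (k + 1) * α₀) + 4 * (3 + 12 * (d : ℝ)) ^ 3 / rho0 d L ^ 2 * ((L : ℝ) ^ (k + 1) * α₀) ^ 2) ^ 2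
        + 4 * (4 * (3 + 12 * (d : ℝ)) ^ 3 / rho0 d L ^ 2 * ((L : ℝ) ^ (k + 1) * α₀) ^ 2) := by
  -- the four bonds of the coarse plaquette of the averaged representative are those of `cavgIter V`
  have h1 : cavgIter L (k + 1) (vary Ft A 1) c μ = cavgIter L (k + 1) V c μ :=
    cavgIter_congr_of_l1 L (k + 1) c (fun x κ hx => hagree x κ (Or.inl hx)) μ
  have h2 : cavgIter L (k + 1) (vary Ft A 1) (c + e μ) ν = cavgIter L (k + 1) V (c + e μ) ν :=
    cavgIter_congr_of_l1 L (k + 1) (c + e μ) (fun x κ hx => hagree x κ (Or.inr (Or.inl hx))) ν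
  have h3 : cavgIter L (k + 1) (vary Ft A 1) (c + e ν) μ = cavgIter L (k + 1) V (c + e ν) μ :=
    cavgIter_congr_of_l1 L (k + 1) (c + e ν) (fun x κ hx => hagree x κ (Or.inr (Or.inr hx))) μ
  have h4 : cavgIter L (k + 1) (vary Ft A 1) c ν = cavgIter L (k + 1) V c ν :=
    cavgIter_congr_of_l1 L (k + 1) c (fun x κ hx => hagree x κ (Or.inl hx)) ν
  have hplaq : hol (cavgIter L (k + 1) (vary Ft A 1)) c (plaqWord μ ν) = hol (cavgIter L (k + 1) V) c (plaqWord μ ν) :=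
    hol_plaqWord_congr h1 h2 h3 h4
  refine coarseCurl_le_at hL k hFt hFtP hFt0 hF0 hA hAP hα₀ hAα hreg c hμν ?_
  rw [hplaq]
  exact hVc

end

end Summit.QuantumFields.BalabanUV.T4Continuum.NE7CoarseCurvatureLetterLocal
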